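import Summits.MatrixMultiplication.MatrixMultiplication.Theorems.FarEdgeDescentSpectralShadow
import Literature.Computability.AlgebraicComplexity.RectangularExponentProofs
import Literature.Computability.AlgebraicComplexity.RectangularExponentSymmetry
import Literature.Computability.AlgebraicComplexity.RectangularExponentUnidimensionalAsymptoticsProofs
import HarnessLib

/-!
# Route `FarEdgeDescent` — Kernel XXI-B «the horn and top isolation»: the generic crux on the spectrum

decomp-mm ROOT cell (D-0178), lens 2 «structural dichotomy: special vs generic», gen 45; companion of
`FarEdgeDescentSpectralShadow` (§1 support function, §2 shadow criteria).  THESES-FREE (imports that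
Theorems module and `Literature` only; item texts inline); every field `K`.  Notation as there:
`θ = specMMPoint K φ`, `d(φ) = θ₁+θ₂+θ₃−2`, `ε(φ) = 1−θ₂`, `f(x) = ω_K(1,x,1)`, `e(x) = f(x) − (x+1)`.

§3 THE HORN (unconditional, every field, every coordinate).  Every spectral line in every coordinate
   lies below the profile: `(θ₁+θ₂+θ₃) + (x−1)θᵢ ≤ f(x)` (`line_le_omegaRect_coord`, symmetry of `ω(a,b,c)`),
   so `d(φ) ≤ (x−1)(1−θᵢ) + e(x)`; Lotti–Romani's Prop. 4.1 proof (Literature `omegaRect_lrAbscissa_sub_le`,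
   every field) gives `e_K(k) ≤ 9/(2·log(k+2))` for every natural `k` (`excess_le_log`), hence the
   LOGARITHMIC HORN `d ≤ inf_k [(k−1)(1 − maxᵢ θᵢ) + 9/(2 log(k+2))]` (`darkness_le_horn_coord`): the faces
   `θᵢ = 1` meet the spectrum in light points only (additive every-field edge rigidity), DARK POINTS — in
   particular the top points of a world with `ω_K > 2` — LIE STRICTLY INSIDE THE CUBE in every coordinate
   (`coord_mem_Ioo_of_dark`: lower bound from the PROVED near cone `α_K > 0.1722`, upper bound from the
   horn), and a CARRIER of direction `x` (a `φ` whose middle line touches `f` at `x`) has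
   `(x−k)·ε(φ) ≤ 9/(2 log(k+2))` for every `k` — quantitative accumulation of far carriers at the edge.
   Any landed rate `ω(1,x,1) ≤ x+1+c` is read the same way (`darkness_le_of_excess_le`).  In this language
   the special crux is exactly «horn ⟹ cone».
§4 THE GENERIC CRUX ON THE SPECTRUM.  The text of `AnchoredLogConvexity` (over any field) is equivalent to:
   every spectral line is dominated, at every doubling midpoint `m`, by the geometric mean
   `√(e(1)e(2m−1))` (`alcShape_iff_spectral`; the profile is the supremum of the lines).  Structure: a TOP
   point (`d(φ) = ω_K−2`, an optimal spectral certificate of the square) carrying a real direction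
   `x₀ > 1` forces `f` to be AFFINE on `[1,x₀]` (`affine_of_top_carrier`, unconditional); and TOP
   ISOLATION (`top_isolated`): if the crux's text holds and `ω_K > 2`, NO top point carries ANY real
   direction `x > 1` — in the generic world with the crux, the square's optimal spectral certificates are
   strictly sub-optimal for every rectangular format `⟨n, n^x, n⟩`, `x > 1` (cross-lens: lens 4's top fibre).

NO definitions (gate rule D-0009).  Nothing here proves `ω = 2`. -/

set_option linter.dupNamespace false

noncomputable section

open scoped BigOperators

namespace Summit.MatrixMultiplication.MatrixMultiplication.Theorems.FarEdgeDescentSpectralHorn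

open Literature.Computability.AlgebraicComplexity
open Summit.MatrixMultiplication.MatrixMultiplication.Theorems.FarEdgeDescentSpectralShadow

variable {K : Type} [Field K]

/-! ## §3 The horn: unconditional, every field, every coordinate -/

/-- **From rational to real abscissae** (the approximation step of `line_le_omegaRect`, abstract form):
if `A + (p/d)·s ≤ ω(1,p/d,1)` for all naturals `p` and `d ≥ 1`, with `s ≥ 0`, then `A + x·s ≤ ω(1,x,1)` for
every real `x ≥ 0` (approximation from above and the `1`-Lipschitz estimate).
[cite: ChristandlLeGallLysikovZuiddam2025, Rem. 3.13] -/
theorem real_of_rat_bound {A s : ℝ} (hs : 0 ≤ s)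
    (hrat : ∀ (p d : ℕ), 1 ≤ d → A + (p : ℝ) / d * s ≤ omegaRect K 1 ((p : ℝ) / d) 1) {x : ℝ}
    (hx : 0 ≤ x) : A + x * s ≤ omegaRect K 1 x 1 := by
  refine le_of_forall_pos_lt_add fun δ hδ => ?_
  obtain ⟨d, hd⟩ := exists_nat_one_div_lt hδ
  set D : ℕ := d + 1 with hD
  have hD1 : 1 ≤ D := by omega
  have hDpos : (0 : ℝ) < D := by exact_mod_cast (by omega : 0 < D)
  set p : ℕ := ⌊x * D⌋₊ + 1 with hp
  have hxp : x ≤ (p : ℝ) / D := by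
    rw [le_div_iff₀ hDpos, hp]
    push_cast
    exact (Nat.lt_floor_add_one (x * D)).le
  have hpx : (p : ℝ) / D ≤ x + 1 / D := by
    rw [div_le_iff₀ hDpos, hp, add_mul, one_div_mul_cancel hDpos.ne']
    push_cast
    have := Nat.floor_le (mul_nonneg hx hDpos.le)
    linarith
  have h1 := hrat p D hD1
  have h2 := omegaRect_one_mid_one_le_add K hxp
  have h3 : x * s ≤ (p : ℝ) / D * s := mul_le_mul_of_nonneg_right hxp hs
  have h4 : (1 : ℝ) / D = 1 / ((d : ℝ) + 1) := by rw [hD]; push_cast; ring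
  linarith

/-- **Spectral lines in every coordinate**: for every `i ∈ {1,2,3}`, every real `x ≥ 0` and every
universal spectral point, `(θ₁+θ₂+θ₃) + (x−1)·θᵢ ≤ ω(1,x,1)` — the pencils `(x,1,1)`, `(1,x,1)`, `(1,1,x)`
have the same exponent (`ω(a,b,c)` is symmetric) and each bounds the line with slope `θᵢ`.
[cite: Strassen1988, Thm. 3.8] [cite: LottiRomani1983, §2 (p. 174)] -/
theorem line_le_omegaRect_coord {F : SpectralMap K} (hF : IsUniversalSpectralPoint K F) (i : Fin 3)
    {x : ℝ} (hx : 0 ≤ x) :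
    (∑ j, specMMPoint K F j) + (x - 1) * specMMPoint K F i ≤ omegaRect K 1 x 1 := by
  have hθ := fun j => (AlmanLi2026.prop42_mem_Icc hF j).1
  rw [sum_three]
  fin_cases i
  · -- slope `θ₁`: the pencil `(x,1,1)`
    have hrat : ∀ (p d : ℕ), 1 ≤ d → (specMMPoint K F 1 + specMMPoint K F 2) +
        (p : ℝ) / d * specMMPoint K F 0 ≤ omegaRect K 1 ((p : ℝ) / d) 1 := by
      intro p d hd
      have hdpos : (0 : ℝ) < d := by exact_mod_cast (by omega : 0 < d)
      have h := line_le_omegaRect_div hF p d d hd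
      rw [div_self hdpos.ne', omegaRect_swap₁₂ K] at h
      have e : ((p : ℝ) * specMMPoint K F 0 + d * specMMPoint K F 1 + d * specMMPoint K F 2) / d =
          specMMPoint K F 1 + specMMPoint K F 2 + (p : ℝ) / d * specMMPoint K F 0 := by
        field_simp
        ring
      rwa [e] at h
    have h := real_of_rat_bound (hθ 0) hrat hx
    show specMMPoint K F 0 + specMMPoint K F 1 + specMMPoint K F 2 + (x - 1) * specMMPoint K F 0 ≤
      omegaRect K 1 x 1
    linarith
  · -- slope `θ₂`: the middle pencil
    have h := line_le_omegaRect hF hx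
    show specMMPoint K F 0 + specMMPoint K F 1 + specMMPoint K F 2 + (x - 1) * specMMPoint K F 1 ≤
      omegaRect K 1 x 1
    linarith
  · -- slope `θ₃`: the pencil `(1,1,x)`
    have hrat : ∀ (p d : ℕ), 1 ≤ d → (specMMPoint K F 0 + specMMPoint K F 1) +
        (p : ℝ) / d * specMMPoint K F 2 ≤ omegaRect K 1 ((p : ℝ) / d) 1 := by
      intro p d hd
      have hdpos : (0 : ℝ) < d := by exact_mod_cast (by omega : 0 < d)
      have h := line_le_omegaRect_div hF d d p hd
      rw [div_self hdpos.ne', ← omegaRect_swap₂₃ K] at h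
      have e : ((d : ℝ) * specMMPoint K F 0 + d * specMMPoint K F 1 + p * specMMPoint K F 2) / d =
          specMMPoint K F 0 + specMMPoint K F 1 + (p : ℝ) / d * specMMPoint K F 2 := by
        field_simp
      rwa [e] at h
    have h := real_of_rat_bound (hθ 2) hrat hx
    show specMMPoint K F 0 + specMMPoint K F 1 + specMMPoint K F 2 + (x - 1) * specMMPoint K F 2 ≤
      omegaRect K 1 x 1
    linarith

/-- **Darkness against an excess bound, every coordinate**: if `ω(1,x,1) ≤ x + 1 + c` (`x ≥ 0`) then
`d(φ) ≤ (x−1)·(1−θᵢ) + c` for every universal spectral point and every `i` — the form in which any landed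
far-edge rate (e.g. the route's `LogRate`, `log 2/log(2k+2)` over `ℂ`) is read on the spectrum.
[cite: Strassen1988, Thm. 3.8] -/
theorem darkness_le_of_excess_le {F : SpectralMap K} (hF : IsUniversalSpectralPoint K F) (i : Fin 3)
    {x c : ℝ} (hx : 0 ≤ x) (hc : omegaRect K 1 x 1 ≤ x + 1 + c) :
    (∑ j, specMMPoint K F j) - 2 ≤ (x - 1) * (1 - specMMPoint K F i) + c := by
  have h := line_le_omegaRect_coord hF i hx
  have e : (x - 1) * (1 - specMMPoint K F i) = (x - 1) - (x - 1) * specMMPoint K F i := by ring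
  rw [e]
  linarith

/-- **Darkness against depth and excess**: `d(φ) ≤ (x−1)·ε(φ) + e(x)` for every real `x ≥ 0`
(`e(x) = ω(1,x,1) − (x+1)`). [cite: Strassen1988, Thm. 3.8] -/
theorem darkness_le_far {F : SpectralMap K} (hF : IsUniversalSpectralPoint K F) {x : ℝ} (hx : 0 ≤ x) :
    (∑ i, specMMPoint K F i) - 2 ≤
      (x - 1) * (1 - specMMPoint K F 1) + (omegaRect K 1 x 1 - (x + 1)) :=
  darkness_le_of_excess_le hF 1 hx (by linarith)

/-- **A far-edge rate over EVERY field**: `ω_K(1,k,1) − (k+1) ≤ 9 / (2·log(k+2))` for every natural `k`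
(Lotti–Romani's Prop. 4.1 proof at the abscissa `x_{k+2} ≤ k`, Literature
`omegaRect_lrAbscissa_sub_le`, and the antitonicity of `x ↦ ω(1,x,1) − x`).
[cite: LottiRomani1983, Prop. 4.1 (pp. 180–181); §2 (p. 174)] -/
theorem excess_le_log (k : ℕ) :
    omegaRect K 1 k 1 - (k + 1) ≤ 9 / (2 * Real.log ((k : ℝ) + 2)) := by
  have hn : 2 ≤ k + 2 := by omega
  have hq := omegaRect_lrAbscissa_sub_le K hn
  have hk0 : (0 : ℝ) ≤ k := Nat.cast_nonneg k
  have hL2 : 0 < Real.log ((k : ℝ) + 2) := Real.log_pos (by linarith)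
  have hlog : Real.log ((k : ℝ) + 1) ≤ Real.log ((k : ℝ) + 2) :=
    Real.log_le_log (by linarith) (by linarith)
  have hcast : (((k + 2 : ℕ) : ℝ)) = (k : ℝ) + 2 := by push_cast; ring
  rw [hcast] at hq
  have e1 : (k : ℝ) + 2 - 2 = k := by ring
  have e2 : (k : ℝ) + 2 - 1 = k + 1 := by ring
  rw [e1, e2] at hq
  -- the abscissa `x = k log(k+1)/log(k+2) ≤ k`
  set x : ℝ := (k : ℝ) * Real.log ((k : ℝ) + 1) / Real.log ((k : ℝ) + 2) with hxdef
  have hxk : x ≤ k := by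
    rw [hxdef, div_le_iff₀ hL2]
    exact mul_le_mul_of_nonneg_left hlog hk0
  have hmono := omegaRect_one_mid_one_sub_antitone K hxk
  simp only at hmono
  linarith

/-- A quantity below every `9/(2·log(k+2))` is `≤ 0`. [folklore] -/
theorem nonpos_of_le_log_rate {a : ℝ} (h : ∀ k : ℕ, a ≤ 9 / (2 * Real.log ((k : ℝ) + 2))) : a ≤ 0 := by
  refine le_of_forall_pos_lt_add fun δ hδ => ?_
  set k : ℕ := ⌈Real.exp (9 / (2 * δ))⌉₊ with hk
  have hk2 : Real.exp (9 / (2 * δ)) < (k : ℝ) + 2 := by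
    have := Nat.le_ceil (Real.exp (9 / (2 * δ)))
    rw [← hk] at this
    linarith
  have hL : 9 / (2 * δ) < Real.log ((k : ℝ) + 2) := by
    have := Real.log_lt_log (Real.exp_pos _) hk2
    rwa [Real.log_exp] at this
  have hsmall : 9 / (2 * Real.log ((k : ℝ) + 2)) < δ := by
    have hLpos : 0 < Real.log ((k : ℝ) + 2) := lt_trans (by positivity) hL
    rw [div_lt_iff₀ (by positivity)]
    have := (div_lt_iff₀ (by positivity : (0 : ℝ) < 2 * δ)).1 hL
    linarith
  linarith [h k]

/-- **THE HORN, every coordinate**: `d(φ) ≤ (k−1)·(1−θᵢ) + 9/(2·log(k+2))` for every universal spectral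
point, every `i`, every natural `k`, every field — the spectrum's shadow lies in the logarithmic horn
`d ≤ inf_k [(k−1)(1 − maxᵢ θᵢ) + 9/(2 log(k+2))]`, which touches the faces `θᵢ = 1` only at `d = 0`.
[cite: LottiRomani1983, Prop. 4.1] [cite: Strassen1988, Thm. 3.8] -/
theorem darkness_le_horn_coord {F : SpectralMap K} (hF : IsUniversalSpectralPoint K F) (i : Fin 3) (k : ℕ) :
    (∑ j, specMMPoint K F j) - 2 ≤
      ((k : ℝ) - 1) * (1 - specMMPoint K F i) + 9 / (2 * Real.log ((k : ℝ) + 2)) :=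
  darkness_le_of_excess_le hF i (Nat.cast_nonneg k) (by linarith [excess_le_log (K := K) k])

/-- **The faces `θᵢ = 1` meet the spectrum in light points only** (every field; the additive, every-
coordinate form of edge rigidity): `θᵢ = 1 ⟹ θ₁+θ₂+θ₃ = 2`. [cite: LottiRomani1983, Prop. 4.1]
[cite: AlmanLiPratt2026, Prop. 8.1] -/
theorem light_of_coord_eq_one {F : SpectralMap K} (hF : IsUniversalSpectralPoint K F) (i : Fin 3)
    (h1 : specMMPoint K F i = 1) : ∑ j, specMMPoint K F j = 2 := by
  refine le_antisymm ?_ (AlmanLi2026.prop42_two_le_sum hF)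
  have h : (∑ j, specMMPoint K F j) - 2 ≤ 0 := by
    refine nonpos_of_le_log_rate fun k => ?_
    have := darkness_le_horn_coord hF i k
    rw [h1, sub_self, mul_zero, zero_add] at this
    exact this
  linarith

/-- **Dark points lie strictly inside the cube in every coordinate**: `θ₁+θ₂+θ₃ > 2 ⟹ 0 < θᵢ < 1` for all
`i` (lower bound: the proved near cone, `α_K > 0.1722`; upper bound: the horn). [cite: Coppersmith1982, Thm. 1]
[cite: LottiRomani1983, Prop. 4.1] -/
theorem coord_mem_Ioo_of_dark {F : SpectralMap K} (hF : IsUniversalSpectralPoint K F)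
    (hd : 2 < ∑ j, specMMPoint K F j) (i : Fin 3) : specMMPoint K F i ∈ Set.Ioo (0 : ℝ) 1 := by
  have hθ := AlmanLi2026.prop42_mem_Icc hF i
  refine ⟨?_, ?_⟩
  · -- near cone in coordinate `i` at `x = 0.1722`
    have hx : (0 : ℝ) ≤ 0.1722 := by norm_num
    have h := line_le_omegaRect_coord hF i hx
    rw [omegaRect_eq_two_of_le_dualExponentAlpha K (coppersmith1982_dualExponentAlpha_gt K).le] at h
    rcases hθ.1.lt_or_eq with hpos | hzero
    · exact hpos
    · rw [← hzero] at h
      norm_num at h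
      linarith
  · rcases hθ.2.lt_or_eq with hlt | heq
    · exact hlt
    · have := light_of_coord_eq_one hF i heq
      linarith

/-- **Top points of a non-saturated world lie strictly inside the cube**: if `ω_K > 2`, every universal
spectral point with `θ₁+θ₂+θ₃ = ω_K` has `0 < θᵢ < 1` for all `i` (unconditional). [cite: AlmanLi2026, Proposition 4.2] -/
theorem top_coord_mem_Ioo (hω : 2 < omega K) {F : SpectralMap K} (hF : IsUniversalSpectralPoint K F)
    (htop : ∑ j, specMMPoint K F j = omega K) (i : Fin 3) : specMMPoint K F i ∈ Set.Ioo (0 : ℝ) 1 :=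
  coord_mem_Ioo_of_dark hF (by linarith) i

/-- **Top points and the cube `⟨2,2,2⟩`** (bridge to the multiplicative top fibre of lens 4):
`θ₁+θ₂+θ₃ = ω_K ⟺ φ⟨2,2,2⟩ = 2^{ω_K}`. [cite: AlmanLi2026, Proposition 4.2] -/
theorem top_iff_cube {F : SpectralMap K} (hF : IsUniversalSpectralPoint K F) :
    ∑ j, specMMPoint K F j = omega K ↔ F (matMulTensor K 2 2 2) = (2 : ℝ) ^ omega K := by
  rw [hF.map_matMulTensor_cube (by norm_num : 1 ≤ 2), Nat.cast_ofNat]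
  refine ⟨fun h => by rw [h], fun h => le_antisymm ?_ ?_⟩
  · exact Real.rpow_le_rpow_left_iff one_lt_two |>.1 h.le
  · exact Real.rpow_le_rpow_left_iff one_lt_two |>.1 h.ge

/-- **Carriers of far directions are shallow (quantitative accumulation at the edge)**: if the line of
`φ` touches the profile at a real `x` (`θ₁ + xθ₂ + θ₃ = ω(1,x,1)`), then for every natural `k`,
`(x − k)·(1 − θ₂) ≤ 9/(2·log(k+2))` (informative for `k < x`: carriers of `x` have depth
`O(1/((x−k) log k))`). [cite: LottiRomani1983, Prop. 4.1] [cite: Strassen1988, Thm. 3.8] -/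
theorem depth_le_of_carrier {F : SpectralMap K} (hF : IsUniversalSpectralPoint K F) {x : ℝ} (k : ℕ)
    (hcar : specMMPoint K F 0 + x * specMMPoint K F 1 + specMMPoint K F 2 = omegaRect K 1 x 1) :
    (x - k) * (1 - specMMPoint K F 1) ≤ 9 / (2 * Real.log ((k : ℝ) + 2)) := by
  have hlow := add_one_le_omegaRect_one_mid_one K x
  rw [← hcar] at hlow
  have h := darkness_le_horn_coord hF 1 k
  have e1 : ((k : ℝ) - 1) * (1 - specMMPoint K F 1) = k - 1 - k * specMMPoint K F 1 + specMMPoint K F 1 := by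
    ring
  have e2 : (x - k) * (1 - specMMPoint K F 1) =
      x - k - x * specMMPoint K F 1 + k * specMMPoint K F 1 := by ring
  rw [sum_three, e1] at h
  rw [e2]
  linarith

/-! ## §4 The generic crux on the spectrum; top isolation -/

/-- **`AnchoredLogConvexity`'s text ⟺ geometric-mean domination of every spectral line**: for all real
`m > 1` and every universal spectral point, `θ₁ + mθ₂ + θ₃ − (m+1) ≤ √(e(1)·e(2m−1))` — the crux read on
the true object (the profile at `m` is the supremum of the lines, `isLUB_line`).  Stated over an arbitrary
field; over `ℂ` the left side is the route item verbatim. [cite: Strassen1988, Thm. 3.8] -/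
theorem alcShape_iff_spectral :
    (∀ m : ℝ, 1 < m →
        (omegaRect K 1 m 1 - (m + 1)) ^ 2 ≤ (omegaRect K 1 1 1 - 2) * (omegaRect K 1 (2 * m - 1) 1 - 2 * m)) ↔
      ∀ m : ℝ, 1 < m → ∀ F : SpectralMap K, IsUniversalSpectralPoint K F →
        specMMPoint K F 0 + m * specMMPoint K F 1 + specMMPoint K F 2 - (m + 1) ≤
          Real.sqrt ((omegaRect K 1 1 1 - 2) * (omegaRect K 1 (2 * m - 1) 1 - 2 * m)) := by
  constructor
  · intro h m hm F hF
    have hm0 : (0 : ℝ) ≤ m := by linarith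
    have hl := line_le_omegaRect hF hm0
    have he : 0 ≤ omegaRect K 1 m 1 - (m + 1) := by
      linarith [add_one_le_omegaRect_one_mid_one K m]
    calc specMMPoint K F 0 + m * specMMPoint K F 1 + specMMPoint K F 2 - (m + 1)
        ≤ omegaRect K 1 m 1 - (m + 1) := by linarith
      _ = Real.sqrt ((omegaRect K 1 m 1 - (m + 1)) ^ 2) := (Real.sqrt_sq he).symm
      _ ≤ Real.sqrt ((omegaRect K 1 1 1 - 2) * (omegaRect K 1 (2 * m - 1) 1 - 2 * m)) :=
          Real.sqrt_le_sqrt (h m hm)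
  · intro h m hm
    have hm0 : (0 : ℝ) ≤ m := by linarith
    set P : ℝ := (omegaRect K 1 1 1 - 2) * (omegaRect K 1 (2 * m - 1) 1 - 2 * m) with hP
    have hP0 : 0 ≤ P := by
      refine mul_nonneg ?_ ?_
      · linarith [add_one_le_omegaRect_one_mid_one K (1 : ℝ)]
      · linarith [add_one_le_omegaRect_one_mid_one K (2 * m - 1)]
    have he : 0 ≤ omegaRect K 1 m 1 - (m + 1) := by
      linarith [add_one_le_omegaRect_one_mid_one K m]
    have hsup : omegaRect K 1 m 1 ≤ (m + 1) + Real.sqrt P := by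
      refine (isLUB_line hm0).2 ?_
      rintro _ ⟨F, hF, rfl⟩
      have := h m hm F hF
      show specMMPoint K F 0 + m * specMMPoint K F 1 + specMMPoint K F 2 ≤ m + 1 + Real.sqrt P
      linarith
    have h1 : omegaRect K 1 m 1 - (m + 1) ≤ Real.sqrt P := by linarith
    calc (omegaRect K 1 m 1 - (m + 1)) ^ 2 ≤ (Real.sqrt P) ^ 2 := pow_le_pow_left₀ he h1 2
      _ = P := Real.sq_sqrt hP0

/-- **A top point that carries a far direction flattens the profile** (unconditional): if
`θ₁+θ₂+θ₃ = ω_K` and the line of `φ` touches `ω(1,·,1)` at some real `x₀ > 1`, then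
`ω(1,y,1) = θ₁ + yθ₂ + θ₃` on the whole interval `[1, x₀]` (convexity of `ω(1,·,1)` against the supporting
line through `(1, ω)` and `(x₀, ω(1,x₀,1))`). [cite: LottiRomani1983, §2 (p. 174)] [cite: Strassen1988, Thm. 3.8] -/
theorem affine_of_top_carrier {F : SpectralMap K} (hF : IsUniversalSpectralPoint K F)
    (htop : ∑ i, specMMPoint K F i = omega K) {x₀ : ℝ} (hx₀ : 1 < x₀)
    (hcar : specMMPoint K F 0 + x₀ * specMMPoint K F 1 + specMMPoint K F 2 = omegaRect K 1 x₀ 1)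
    {y : ℝ} (hy1 : 1 ≤ y) (hyx : y ≤ x₀) :
    omegaRect K 1 y 1 = specMMPoint K F 0 + y * specMMPoint K F 1 + specMMPoint K F 2 := by
  refine le_antisymm ?_ (line_le_omegaRect hF (by linarith))
  have hx1 : (0 : ℝ) < x₀ - 1 := by linarith
  have hne : x₀ - 1 ≠ 0 := hx1.ne'
  set t : ℝ := (y - 1) / (x₀ - 1) with ht
  have ht0 : 0 ≤ t := div_nonneg (by linarith) hx1.le
  have ht1 : t ≤ 1 := by
    rw [ht, div_le_one hx1]
    linarith
  have htx : t * x₀ - t = y - 1 := by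
    have h1 : t * (x₀ - 1) = y - 1 := by
      rw [ht]
      exact div_mul_cancel₀ (y - 1) hne
    rw [← h1]
    ring
  have hconv := (omegaRect_convexOn_one_mid_one K).2 (Set.mem_Ici.2 (zero_le_one : (0 : ℝ) ≤ 1))
    (Set.mem_Ici.2 (by linarith : (0 : ℝ) ≤ x₀)) (sub_nonneg.2 ht1) ht0 (by ring : (1 - t) + t = 1)
  simp only [smul_eq_mul, mul_one] at hconv
  have ey : 1 - t + t * x₀ = y := by linarith
  rw [ey] at hconv
  have f1 : omegaRect K 1 1 1 = specMMPoint K F 0 + specMMPoint K F 1 + specMMPoint K F 2 := by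
    rw [omegaRect_one_one_one, ← htop, sum_three]
  rw [f1, ← hcar] at hconv
  have e : (1 - t) * (specMMPoint K F 0 + specMMPoint K F 1 + specMMPoint K F 2) +
      t * (specMMPoint K F 0 + x₀ * specMMPoint K F 1 + specMMPoint K F 2) =
        specMMPoint K F 0 + (1 - t + t * x₀) * specMMPoint K F 1 + specMMPoint K F 2 := by ring
  rw [e, ey] at hconv
  exact hconv

/-- **TOP ISOLATION**: if the text of `AnchoredLogConvexity` holds over `K` and `ω_K > 2`, then no TOP
spectral point (`θ₁+θ₂+θ₃ = ω_K`, an optimal spectral certificate of `⟨n,n,n⟩`) carries any real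
direction `x > 1`: its line is STRICTLY below `ω(1,x,1)` for every `x > 1`.  (A top carrier of `x` makes
the excess affine on `[1,x]`; the anchored inequality at the midpoint `m = (x+1)/2` is then AM ≤ GM with
equality, forcing `e(1) = e(x)`, i.e. `θ₂ = 1`, and a depth-zero point is light — contradiction.)
[cite: Strassen1988, Thm. 3.8] [cite: LottiRomani1983, Prop. 4.1] -/
theorem top_isolated
    (hALC : ∀ m : ℝ, 1 < m →
      (omegaRect K 1 m 1 - (m + 1)) ^ 2 ≤ (omegaRect K 1 1 1 - 2) * (omegaRect K 1 (2 * m - 1) 1 - 2 * m))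
    (hω : 2 < omega K) {F : SpectralMap K} (hF : IsUniversalSpectralPoint K F)
    (htop : ∑ i, specMMPoint K F i = omega K) {x : ℝ} (hx : 1 < x) :
    specMMPoint K F 0 + x * specMMPoint K F 1 + specMMPoint K F 2 < omegaRect K 1 x 1 := by
  refine lt_of_le_of_ne (line_le_omegaRect hF (by linarith)) fun hcar => ?_
  have hm1 : 1 < (x + 1) / 2 := by linarith
  have hmx : (x + 1) / 2 ≤ x := by linarith
  have e2m : 2 * ((x + 1) / 2) - 1 = x := by ring
  -- the profile is affine on `[1, x]`, in particular at the midpoint `(x+1)/2`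
  have hfm := affine_of_top_carrier hF htop hx hcar hm1.le hmx
  have f1 : omegaRect K 1 1 1 = specMMPoint K F 0 + specMMPoint K F 1 + specMMPoint K F 2 := by
    rw [omegaRect_one_one_one, ← htop, sum_three]
  have h := hALC ((x + 1) / 2) hm1
  rw [e2m, hfm, f1, ← hcar] at h
  -- AM ≤ GM with equality: `(e(1) − e(x))² = 4·(AM² − GM²) ≤ 0`
  have key : ∀ a b c : ℝ, ((a + b + c - 2) - (a + x * b + c - (x + 1))) ^ 2 =
      4 * ((a + (x + 1) / 2 * b + c - ((x + 1) / 2 + 1)) ^ 2 -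
        (a + b + c - 2) * (a + x * b + c - 2 * ((x + 1) / 2))) := by
    intro a b c
    ring
  have hsq : ((specMMPoint K F 0 + specMMPoint K F 1 + specMMPoint K F 2 - 2) -
      (specMMPoint K F 0 + x * specMMPoint K F 1 + specMMPoint K F 2 - (x + 1))) ^ 2 ≤ 0 := by
    rw [key]
    linarith [h]
  have hzero : (specMMPoint K F 0 + specMMPoint K F 1 + specMMPoint K F 2 - 2) -
      (specMMPoint K F 0 + x * specMMPoint K F 1 + specMMPoint K F 2 - (x + 1)) = 0 :=
    pow_eq_zero_iff two_ne_zero |>.1 (le_antisymm hsq (sq_nonneg _))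
  have hprod : (1 - x) * (specMMPoint K F 1 - 1) = 0 := by
    have e : (specMMPoint K F 0 + specMMPoint K F 1 + specMMPoint K F 2 - 2) -
        (specMMPoint K F 0 + x * specMMPoint K F 1 + specMMPoint K F 2 - (x + 1)) =
          (1 - x) * (specMMPoint K F 1 - 1) := by ring
    rw [← e]
    exact hzero
  rcases mul_eq_zero.1 hprod with h1 | h1
  · linarith
  · have hθ : specMMPoint K F 1 = 1 := by linarith
    have := light_of_coord_eq_one hF 1 hθ
    linarith

end Summit.MatrixMultiplication.MatrixMultiplication.Theorems.FarEdgeDescentSpectralHorn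

end
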